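import Mathlib
import Summits.ValiantsHypothesis.ValiantsHypothesis.Theorems.LacunarySymmetroidMatrixDescartesDefiniteMomentsZonesPlanar

/-!
# `MatrixDescartes` (stmt-ValiantsHypothesis-18050) — the DEFINITE-MOMENTS LAW, zones VII: THE LACUNARY MARKUS THEOREM —
# Rayleigh-sharp ⇒ separated spectral zones ⇒ K alternating definite scales ⇒ `Z₊ ≤ (K−1)·m`

HONEST FRAMING.  Cell `pub-symmetroid`, seat `val-sym-mdr-p2` (gen 15); helper file `--supports` the crux
`Theses.LacunarySymmetroid.MatrixDescartes`, NO closure claim.  An INTRINSIC sector law beside the crux (the hypothesis is a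
property of the pencil's Rayleigh `K`-nomials, no test points, no magnitudes); nothing here bears on the crux in its window,
on `stub_twoSided`, on `DoorA26`/`DoorA34`, registers, or `VP ≠ VNP`.

THEOREM (`card_posRoots_le_of_rayleighSharp`).  `F(x) = ∑ₗ x^{dₗ} Sₗ` with `K ≥ 2` real symmetric `ι × ι` letters at
strictly increasing exponents.  If every Rayleigh `K`-nomial `P_u = ∑ₗ (uᵀSₗu) X^{dₗ}` (`u ≠ 0`) has `K − 1` distinct positive
roots (Descartes' maximum: RAYLEIGH-SHARP), then `det F` has at most `(K − 1)·card ι` distinct positive zeros — Descartes'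
rule with multiplicity `m` holds on the intrinsic hyperbolic sector.  Route: `exists_alternatingScales_of_rayleighSharp`
(THE LACUNARY MARKUS THEOREM: `K` scales `0 < a₀ < ⋯ < a_{K−1}` with `σ(−1)ʲ F(aⱼ) ≻ 0` EXIST) + Theorem C of
`…DefiniteMomentsDescartes` (`card_posRoots_le_of_alternatingMoments`, gen 14).  The scales come from the SEPARATION OF
THE SPECTRAL ZONES `Δⱼ = {j-th positive root of P_u : u ≠ 0}`: `max Δⱼ < min Δⱼ₊₁` — pairwise by the planar index
argument (`…ZonesPlanar.zone_pair_count`), with max / min attained because the root functions are continuous on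
`{u ≠ 0}` (`rootFn_continuousOn`, from `…ZonesLocal.locRoots`) and constant on rays, hence extremised on the compact unit
sphere.  This is the lacunary, real-symmetric analogue of Markus' theorem on the spectral zones of hyperbolic pencils
(A.S. Markus, Introduction to the spectral theory of polynomial operator pencils, 1988, §31) behind
[cite: CameronPsarrakos2019, Thm 3]. [folklore]; axioms `propext`, `Classical.choice`, `Quot.sound`; no definitions.
-/

-- layout Summits/ValiantsHypothesis/ValiantsHypothesis forces the duplicated namespace component
set_option linter.dupNamespace false

namespace Summit.ValiantsHypothesis.ValiantsHypothesis.Theorems.LacunarySymmetroidMatrixDescartes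

open Polynomial Matrix Finset
open scoped BigOperators Topology

namespace DefiniteMoments

/-! ## §1 Root functions -/

section RootFn

variable {ι : Type} [Fintype ι]

/-- Two strictly increasing enumerations of the same finite set of reals coincide. [folklore] -/
theorem enum_unique {n : ℕ} (T : Finset ℝ) (f g : Fin n → ℝ) (hf : StrictMono f) (hg : StrictMono g)
    (hfT : ∀ x : ℝ, x ∈ T ↔ ∃ i, f i = x) (hgT : ∀ x : ℝ, x ∈ T ↔ ∃ i, g i = x) : f = g := by
  classical
  have hcard : T.card = n := by
    have h : T = Finset.univ.image f := by
      ext x; rw [hfT, Finset.mem_image]; simp only [Finset.mem_univ, true_and]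
    rw [h, Finset.card_image_of_injective _ hf.injective, Finset.card_univ, Fintype.card_fin]
  have h1 := Finset.orderEmbOfFin_unique hcard (fun i => (hfT (f i)).2 ⟨i, rfl⟩) hf
  have h2 := Finset.orderEmbOfFin_unique hcard (fun i => (hgT (g i)).2 ⟨i, rfl⟩) hg
  rw [h1, h2]

/-- **Root functions.**  On a Rayleigh-sharp pencil there is `ρ : (ι → ℝ) → Fin (K−1) → ℝ` such that for every `u ≠ 0`,
`ρ u` is the strictly increasing enumeration of the positive roots of `P_u`. [folklore] -/
theorem exists_rootFn {K : ℕ} (hK : 2 ≤ K) (d : Fin K → ℕ) (S : Fin K → Matrix ι ι ℝ)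
    (hsharp : ∀ v : ι → ℝ, v ≠ 0 →
      K ≤ ((∑ l, C (v ⬝ᵥ (S l *ᵥ v)) * (X : ℝ[X]) ^ d l).roots.toFinset.filter (fun t => 0 < t)).card + 1) :
    ∃ ρ : (ι → ℝ) → Fin (K - 1) → ℝ, ∀ u : ι → ℝ, u ≠ 0 → StrictMono (ρ u) ∧
      ∀ x : ℝ, x ∈ ((∑ l, C (u ⬝ᵥ (S l *ᵥ u)) * (X : ℝ[X]) ^ d l).roots.toFinset.filter (fun t => 0 < t))
        ↔ ∃ i, ρ u i = x := by
  classical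
  refine ⟨fun u => if h : u ≠ 0 then Classical.choose (exists_enum_posRoots hK d S hsharp u h) else fun _ => 0,
    fun u hu => ?_⟩
  simp only [dif_pos hu]
  exact Classical.choose_spec (exists_enum_posRoots hK d S hsharp u hu)

/-- Root functions are constant on rays: `ρ (c·u) = ρ u` (`c ≠ 0`). [folklore] -/
theorem rootFn_smul {K : ℕ} (d : Fin K → ℕ) (S : Fin K → Matrix ι ι ℝ) (ρ : (ι → ℝ) → Fin (K - 1) → ℝ)
    (hρ : ∀ u : ι → ℝ, u ≠ 0 → StrictMono (ρ u) ∧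
      ∀ x : ℝ, x ∈ ((∑ l, C (u ⬝ᵥ (S l *ᵥ u)) * (X : ℝ[X]) ^ d l).roots.toFinset.filter (fun t => 0 < t))
        ↔ ∃ i, ρ u i = x)
    {c : ℝ} (hc : c ≠ 0) (u : ι → ℝ) (hu : u ≠ 0) : ρ (c • u) = ρ u := by
  have hcu : c • u ≠ 0 := smul_ne_zero hc hu
  obtain ⟨hm1, hT1⟩ := hρ (c • u) hcu
  obtain ⟨hm2, hT2⟩ := hρ u hu
  refine enum_unique _ _ _ hm1 hm2 hT1 fun x => ?_
  rw [← hT2 x, posRoots_smul d S hc u]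

/-- **Continuity of the root functions on `{u ≠ 0}`** (from `locRoots`: one root per window near `u`). [folklore] -/
theorem rootFn_continuousOn {K : ℕ} (hK : 2 ≤ K) (d : Fin K → ℕ) (S : Fin K → Matrix ι ι ℝ)
    (hsharp : ∀ v : ι → ℝ, v ≠ 0 →
      K ≤ ((∑ l, C (v ⬝ᵥ (S l *ᵥ v)) * (X : ℝ[X]) ^ d l).roots.toFinset.filter (fun t => 0 < t)).card + 1)
    (ρ : (ι → ℝ) → Fin (K - 1) → ℝ)
    (hρ : ∀ u : ι → ℝ, u ≠ 0 → StrictMono (ρ u) ∧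
      ∀ x : ℝ, x ∈ ((∑ l, C (u ⬝ᵥ (S l *ᵥ u)) * (X : ℝ[X]) ^ d l).roots.toFinset.filter (fun t => 0 < t))
        ↔ ∃ i, ρ u i = x)
    (i : Fin (K - 1)) : ContinuousOn (fun u => ρ u i) {u : ι → ℝ | u ≠ 0} := by
  rw [Metric.continuousOn_iff]
  intro u hu ε hε
  obtain ⟨hmono, hT⟩ := hρ u hu
  have hP0 := rayleighPoly_ne_zero_of_sharp hK d S hsharp u hu
  have hr0 : ∀ i, 0 < ρ u i := fun i => ((mem_posRoots_iff d S u hP0 _).1 ((hT _).2 ⟨i, rfl⟩)).1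
  obtain ⟨δ, hδ, hδ0, hsep, hδE⟩ := exists_window_radius (ρ u) hmono hr0 {ε} (by simpa using hε)
  obtain ⟨η, hη, hloc⟩ := locRoots hK d S hsharp u hu (ρ u) hmono hT hδ hδ0 hsep
  refine ⟨η, hη, fun u' hu' hdist => ?_⟩
  obtain ⟨z, hz, hzT⟩ := hloc u' hdist
  obtain ⟨hmono', hT'⟩ := hρ u' hu'
  have heq : ρ u' = z := enum_unique _ (ρ u') z hmono' (strictMono_of_windows (ρ u) z δ hsep hz) hT' hzT
  show dist (ρ u' i) (ρ u i) < ε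
  have hε' := hδE ε (by simp)
  rw [Real.dist_eq, heq, abs_sub_lt_iff]
  constructor <;> linarith [(hz i).1, (hz i).2]

/-- **Extremal vectors.**  For non-empty `ι` each root function attains its maximum and its minimum over `{u ≠ 0}`
(continuity on the compact unit sphere; constancy on rays). [folklore] -/
theorem exists_extremal_vectors [Nonempty ι] {K : ℕ} (hK : 2 ≤ K) (d : Fin K → ℕ) (S : Fin K → Matrix ι ι ℝ)
    (hsharp : ∀ v : ι → ℝ, v ≠ 0 →
      K ≤ ((∑ l, C (v ⬝ᵥ (S l *ᵥ v)) * (X : ℝ[X]) ^ d l).roots.toFinset.filter (fun t => 0 < t)).card + 1)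
    (ρ : (ι → ℝ) → Fin (K - 1) → ℝ)
    (hρ : ∀ u : ι → ℝ, u ≠ 0 → StrictMono (ρ u) ∧
      ∀ x : ℝ, x ∈ ((∑ l, C (u ⬝ᵥ (S l *ᵥ u)) * (X : ℝ[X]) ^ d l).roots.toFinset.filter (fun t => 0 < t))
        ↔ ∃ i, ρ u i = x)
    (i : Fin (K - 1)) :
    (∃ uM : ι → ℝ, uM ≠ 0 ∧ ∀ u : ι → ℝ, u ≠ 0 → ρ u i ≤ ρ uM i) ∧
      (∃ um : ι → ℝ, um ≠ 0 ∧ ∀ u : ι → ℝ, u ≠ 0 → ρ um i ≤ ρ u i) := by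
  set Sph := Metric.sphere (0 : ι → ℝ) 1 with hSph
  have hcpt : IsCompact Sph := isCompact_sphere 0 1
  have hsub : Sph ⊆ {u : ι → ℝ | u ≠ 0} := by
    intro u hu h0
    rw [hSph, mem_sphere_zero_iff_norm, h0, norm_zero] at hu
    exact zero_ne_one hu
  -- normalisation onto the sphere
  have hnorm : ∀ u : ι → ℝ, u ≠ 0 → ‖u‖⁻¹ • u ∈ Sph ∧ ‖u‖⁻¹ ≠ 0 := by
    intro u hu
    have hn : ‖u‖ ≠ 0 := norm_ne_zero_iff.2 hu
    refine ⟨?_, inv_ne_zero hn⟩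
    rw [hSph, mem_sphere_zero_iff_norm, norm_smul, norm_inv, norm_norm, inv_mul_cancel₀ hn]
  have hne : Sph.Nonempty := by
    have h1 : (fun _ : ι => (1 : ℝ)) ≠ 0 := by
      intro h
      have := congrFun h (Classical.arbitrary ι)
      simp at this
    exact ⟨_, (hnorm _ h1).1⟩
  have hcont : ContinuousOn (fun u => ρ u i) Sph := (rootFn_continuousOn hK d S hsharp ρ hρ i).mono hsub
  constructor
  · obtain ⟨uM, huM, hmax⟩ := hcpt.exists_isMaxOn hne hcont
    refine ⟨uM, hsub huM, fun u hu => ?_⟩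
    obtain ⟨hmem, hc⟩ := hnorm u hu
    have h : ρ (‖u‖⁻¹ • u) i ≤ ρ uM i := hmax hmem
    rwa [rootFn_smul d S ρ hρ hc u hu] at h
  · obtain ⟨um, hum, hmin⟩ := hcpt.exists_isMinOn hne hcont
    refine ⟨um, hsub hum, fun u hu => ?_⟩
    obtain ⟨hmem, hc⟩ := hnorm u hu
    have h : ρ um i ≤ ρ (‖u‖⁻¹ • u) i := hmin hmem
    rwa [rootFn_smul d S ρ hρ hc u hu] at h

end RootFn

/-! ## §2 Separation of the zones and the alternating scales -/

section Scales

variable {ι : Type} [Fintype ι]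

/-- `#{i : Fin n // i < j} = j` for `j ≤ n`. [folklore] -/
theorem card_filter_val_lt (n j : ℕ) (hj : j ≤ n) :
    ((Finset.univ : Finset (Fin n)).filter (fun i : Fin n => (i : ℕ) < j)).card = j := by
  rcases hj.lt_or_eq with hlt | heq
  · have h : (Finset.univ : Finset (Fin n)).filter (fun i : Fin n => (i : ℕ) < j) = Finset.Iio (⟨j, hlt⟩ : Fin n) := by
      ext i; simp [Fin.lt_def]
    rw [h, Fin.card_Iio]
  · subst heq
    have h : (Finset.univ : Finset (Fin j)).filter (fun i : Fin j => (i : ℕ) < j) = Finset.univ :=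
      Finset.filter_true_of_mem fun i _ => i.isLt
    rw [h, Finset.card_univ, Fintype.card_fin]

/-- **PAIRWISE ZONE ORDER in root-function form**: the `i`-th positive root of `P_v` lies strictly below the `(i+1)`-st
positive root of `P_w`, for all `v, w ≠ 0`. [folklore] -/
theorem root_lt_root_succ {K : ℕ} (hK : 2 ≤ K) (d : Fin K → ℕ) (hd : StrictMono d) (S : Fin K → Matrix ι ι ℝ)
    (hS : ∀ l, (S l).IsSymm)
    (hsharp : ∀ v : ι → ℝ, v ≠ 0 →
      K ≤ ((∑ l, C (v ⬝ᵥ (S l *ᵥ v)) * (X : ℝ[X]) ^ d l).roots.toFinset.filter (fun t => 0 < t)).card + 1)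
    (σ : ℝ) (hσ : ∀ (l : Fin K) (v : ι → ℝ), v ≠ 0 → 0 < σ * (-1) ^ (l : ℕ) * (v ⬝ᵥ (S l *ᵥ v)))
    (ρ : (ι → ℝ) → Fin (K - 1) → ℝ)
    (hρ : ∀ u : ι → ℝ, u ≠ 0 → StrictMono (ρ u) ∧
      ∀ x : ℝ, x ∈ ((∑ l, C (u ⬝ᵥ (S l *ᵥ u)) * (X : ℝ[X]) ^ d l).roots.toFinset.filter (fun t => 0 < t))
        ↔ ∃ i, ρ u i = x)
    (v w : ι → ℝ) (hv : v ≠ 0) (hw : w ≠ 0) (i j : Fin (K - 1)) (hij : (j : ℕ) = i + 1) : ρ v i < ρ w j := by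
  classical
  by_contra hle
  push Not at hle
  obtain ⟨hmv, hTv⟩ := hρ v hv
  obtain ⟨hmw, hTw⟩ := hρ w hw
  have hPv0 := rayleighPoly_ne_zero_of_sharp hK d S hsharp v hv
  have hx : 0 < ρ v i := ((mem_posRoots_iff d S v hPv0 _).1 ((hTv _).2 ⟨i, rfl⟩)).1
  have h := zone_pair_count hK d hd S hS hsharp σ hσ v w hv hw hx
  rw [rootsBelow_enum d S v (ρ v) hmv.injective hTv, rootsUpTo_enum d S w (ρ w) hmw.injective hTw,
    filter_lt_enum (ρ v) hmv i] at h
  have h1 : ((Finset.univ : Finset (Fin (K - 1))).filter (fun i' => i' < i)).card = i := by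
    have e : (Finset.univ : Finset (Fin (K - 1))).filter (fun i' => i' < i) = Finset.Iio i := by ext; simp
    rw [e, Fin.card_Iio]
  have h2 : (j : ℕ) + 1 ≤ ((Finset.univ : Finset (Fin (K - 1))).filter (fun i' => ρ w i' ≤ ρ v i)).card := by
    have e : (Finset.Iic j).card = (j : ℕ) + 1 := Fin.card_Iic j
    rw [← e]
    refine Finset.card_le_card fun i' hi' => ?_
    rw [Finset.mem_Iic] at hi'
    rw [Finset.mem_filter]
    exact ⟨Finset.mem_univ _, (hmw.monotone hi').trans hle⟩
  omega

/-- **One alternating scale per gap.**  For non-empty `ι` and every `j ≤ K − 1` there is a scale `a > 0` at which EVERY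
Rayleigh `K`-nomial `P_u` (`u ≠ 0`) has exactly `j` roots below `a` and does not vanish: `a` lies above the maximum of the
`j`-th zone and below the minimum of the `(j+1)`-st. [folklore] -/
theorem exists_scale [Nonempty ι] {K : ℕ} (hK : 2 ≤ K) (d : Fin K → ℕ) (hd : StrictMono d)
    (S : Fin K → Matrix ι ι ℝ) (hS : ∀ l, (S l).IsSymm)
    (hsharp : ∀ v : ι → ℝ, v ≠ 0 →
      K ≤ ((∑ l, C (v ⬝ᵥ (S l *ᵥ v)) * (X : ℝ[X]) ^ d l).roots.toFinset.filter (fun t => 0 < t)).card + 1)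
    (σ : ℝ) (hσ : ∀ (l : Fin K) (v : ι → ℝ), v ≠ 0 → 0 < σ * (-1) ^ (l : ℕ) * (v ⬝ᵥ (S l *ᵥ v)))
    (j : ℕ) (hj : j ≤ K - 1) :
    ∃ a : ℝ, 0 < a ∧ ∀ u : ι → ℝ, u ≠ 0 →
      ((∑ l, C (u ⬝ᵥ (S l *ᵥ u)) * (X : ℝ[X]) ^ d l).roots.toFinset.filter (fun t => 0 < t ∧ t < a)).card = j ∧
        u ⬝ᵥ ((∑ k, a ^ d k • S k) *ᵥ u) ≠ 0 := by
  classical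
  obtain ⟨ρ, hρ⟩ := exists_rootFn hK d S hsharp
  have hpos : ∀ u : ι → ℝ, u ≠ 0 → ∀ i, 0 < ρ u i := fun u hu i =>
    ((mem_posRoots_iff d S u (rayleighPoly_ne_zero_of_sharp hK d S hsharp u hu) _).1 (((hρ u hu).2 _).2 ⟨i, rfl⟩)).1
  -- lower barrier: above all `i`-th roots with `i < j`; upper barrier: below all `i`-th roots with `j ≤ i`
  obtain ⟨lo, up, hlo0, hloup, hup0, hlo, hup⟩ : ∃ lo up : ℝ, 0 ≤ lo ∧ lo < up ∧ 0 < up ∧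
      (∀ u : ι → ℝ, u ≠ 0 → ∀ i : Fin (K - 1), (i : ℕ) < j → ρ u i ≤ lo) ∧
      (∀ u : ι → ℝ, u ≠ 0 → ∀ i : Fin (K - 1), j ≤ (i : ℕ) → up ≤ ρ u i) := by
    by_cases hj0 : j = 0
    · -- lowest gap: below the minimum of the first zone
      subst hj0
      have i0 : Fin (K - 1) := ⟨0, by omega⟩
      obtain ⟨-, ⟨um, hum, hmin⟩⟩ := exists_extremal_vectors hK d S hsharp ρ hρ ⟨0, by omega⟩
      refine ⟨0, ρ um ⟨0, by omega⟩, le_rfl, hpos um hum _, hpos um hum _, fun u hu i hi => absurd hi (Nat.not_lt_zero _),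
        fun u hu i _ => (hmin u hu).trans ((hρ u hu).1.monotone (Fin.mk_le_mk.2 (Nat.zero_le _)))⟩
    · obtain ⟨⟨uM, huM, hmax⟩, -⟩ := exists_extremal_vectors hK d S hsharp ρ hρ ⟨j - 1, by omega⟩
      have hloall : ∀ u : ι → ℝ, u ≠ 0 → ∀ i : Fin (K - 1), (i : ℕ) < j → ρ u i ≤ ρ uM ⟨j - 1, by omega⟩ :=
        fun u hu i hi => ((hρ u hu).1.monotone (Fin.mk_le_mk.2 (by omega))).trans (hmax u hu)
      by_cases hjn : j = K - 1
      · -- highest gap: above the maximum of the last zone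
        refine ⟨ρ uM ⟨j - 1, by omega⟩, ρ uM ⟨j - 1, by omega⟩ + 1, (hpos uM huM _).le, by linarith,
          by linarith [hpos uM huM ⟨j - 1, by omega⟩], hloall, fun u hu i hi => ?_⟩
        have := i.isLt; omega
      · -- interior gap: between the maximum of zone `j-1` and the minimum of zone `j`
        obtain ⟨-, ⟨um, hum, hmin⟩⟩ := exists_extremal_vectors hK d S hsharp ρ hρ ⟨j, by omega⟩
        have hsep : ρ uM ⟨j - 1, by omega⟩ < ρ um ⟨j, by omega⟩ :=
          root_lt_root_succ hK d hd S hS hsharp σ hσ ρ hρ uM um huM hum _ _ (by simp only []; omega)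
        refine ⟨ρ uM ⟨j - 1, by omega⟩, ρ um ⟨j, by omega⟩, (hpos uM huM _).le, hsep, hpos um hum _, hloall,
          fun u hu i hi => (hmin u hu).trans ((hρ u hu).1.monotone (Fin.mk_le_mk.2 hi))⟩
  refine ⟨(lo + up) / 2, by linarith, fun u hu => ?_⟩
  obtain ⟨hmono, hT⟩ := hρ u hu
  have hiff : ∀ i : Fin (K - 1), ρ u i < (lo + up) / 2 ↔ (i : ℕ) < j := by
    intro i
    constructor
    · intro h
      by_contra hge
      push Not at hge
      have := hup u hu i hge
      linarith
    · intro h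
      have := hlo u hu i h
      linarith
  have hne : ∀ i : Fin (K - 1), ρ u i ≠ (lo + up) / 2 := by
    intro i h
    by_cases hi : (i : ℕ) < j
    · have := hlo u hu i hi; linarith
    · push Not at hi; have := hup u hu i hi; linarith
  constructor
  · rw [rootsBelow_enum d S u (ρ u) hmono.injective hT, ← card_filter_val_lt (K - 1) j hj]
    congr 1
    ext i
    simp only [Finset.mem_filter, Finset.mem_univ, true_and, hiff]
  · intro h0
    have hP0 := rayleighPoly_ne_zero_of_sharp hK d S hsharp u hu
    obtain ⟨i, hi⟩ := (hT _).1 ((mem_posRoots_iff d S u hP0 _).2 ⟨by linarith, h0⟩)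
    exact hne i hi

/-- **THE LACUNARY MARKUS THEOREM (alternating scales exist).**  `K ≥ 2` real symmetric letters at strictly increasing
exponents, Rayleigh-sharp.  Then there are a global sign `σ = ±1` and scales `0 < a₀ < a₁ < ⋯ < a_{K−1}` with
`σ·(−1)ʲ·vᵀF(aⱼ)v > 0` for every `v ≠ 0` — `F` is DEFINITE with ALTERNATING signs at `K` scales (the hypothesis of
Theorem C `card_posRoots_le_of_alternatingMoments`). [folklore] -/
theorem exists_alternatingScales_of_rayleighSharp {K : ℕ} (hK : 2 ≤ K) (d : Fin K → ℕ) (hd : StrictMono d)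
    (S : Fin K → Matrix ι ι ℝ) (hS : ∀ l, (S l).IsSymm)
    (hsharp : ∀ v : ι → ℝ, v ≠ 0 →
      K ≤ ((∑ l, C (v ⬝ᵥ (S l *ᵥ v)) * (X : ℝ[X]) ^ d l).roots.toFinset.filter (fun t => 0 < t)).card + 1) :
    ∃ (a : Fin (K - 1 + 1) → ℝ) (σ : ℝ), StrictMono a ∧ 0 < a 0 ∧ (σ = 1 ∨ σ = -1) ∧
      ∀ (j : Fin (K - 1 + 1)) (v : ι → ℝ), v ≠ 0 →
        0 < σ * (-1) ^ (j : ℕ) * (v ⬝ᵥ ((∑ k, a j ^ d k • S k) *ᵥ v)) := by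
  classical
  rcases isEmpty_or_nonempty ι with hι | hι
  · refine ⟨fun j => (j : ℝ) + 1, 1, fun i j h => ?_, by simp, Or.inl rfl, fun j v hv => absurd (Subsingleton.elim v 0) hv⟩
    have h' : (i : ℕ) < (j : ℕ) := h
    show (i : ℝ) + 1 < (j : ℝ) + 1
    exact_mod_cast Nat.succ_lt_succ h'
  · -- a non-zero vector and the global sign
    have hv₀ : (fun _ : ι => (1 : ℝ)) ≠ 0 := by
      intro h
      have := congrFun h (Classical.arbitrary ι)
      simp at this
    obtain ⟨σ, hσ1, hσ⟩ := alternatingDefinite_of_rayleighSharp hK d hd S hsharp _ hv₀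
    have hsc : ∀ j : Fin (K - 1 + 1), ∃ a : ℝ, 0 < a ∧ ∀ u : ι → ℝ, u ≠ 0 →
        ((∑ l, C (u ⬝ᵥ (S l *ᵥ u)) * (X : ℝ[X]) ^ d l).roots.toFinset.filter (fun t => 0 < t ∧ t < a)).card = j ∧
          u ⬝ᵥ ((∑ k, a ^ d k • S k) *ᵥ u) ≠ 0 :=
      fun j => exists_scale hK d hd S hS hsharp σ hσ j (by have := j.isLt; omega)
    choose a ha0 ha using hsc
    refine ⟨a, σ, fun i j hij => ?_, ha0 0, hσ1, fun j v hv => ?_⟩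
    · -- strict monotonicity from the root counts of one fixed vector
      by_contra hle
      push Not at hle
      have h1 := (ha i _ hv₀).1
      have h2 := (ha j _ hv₀).1
      have hmono := card_rootsBelow_mono (∑ l, C ((fun _ : ι => (1 : ℝ)) ⬝ᵥ (S l *ᵥ fun _ : ι => (1 : ℝ)))
        * (X : ℝ[X]) ^ d l) hle
      rw [h1, h2] at hmono
      exact absurd hmono (not_le.2 hij)
    · obtain ⟨hcount, hne⟩ := ha j v hv
      have hnr : ¬ (∑ l, C (v ⬝ᵥ (S l *ᵥ v)) * (X : ℝ[X]) ^ d l).IsRoot (a j) :=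
        fun h => hne ((isRoot_iff_form_eq_zero d S v (a j)).1 h)
      have h := rayleigh_sign_law hK d hd S hsharp σ hσ v hv (ha0 j) hnr
      rwa [hcount] at h

/-- **DESCARTES' RULE WITH MULTIPLICITY `m` ON THE INTRINSIC HYPERBOLIC SECTOR.**  `F(x) = ∑ₗ x^{dₗ} Sₗ` with `K ≥ 2`
real symmetric `ι × ι` letters at strictly increasing exponents; if every Rayleigh `K`-nomial `∑ₗ (vᵀSₗv) X^{dₗ}`
(`v ≠ 0`) has `K − 1` distinct positive roots, then `det (∑ₗ X^{dₗ} Sₗ)` has at most `(K − 1)·card ι` distinct positive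
zeros.  (Lacunary Markus theorem + Theorem C; the lacunary, certificate-free form of [cite: CameronPsarrakos2019, Thm 3].)
[folklore] -/
theorem card_posRoots_le_of_rayleighSharp [DecidableEq ι] {K : ℕ} (hK : 2 ≤ K) (d : Fin K → ℕ) (hd : StrictMono d)
    (S : Fin K → Matrix ι ι ℝ) (hS : ∀ l, (S l).IsSymm)
    (hsharp : ∀ v : ι → ℝ, v ≠ 0 →
      K ≤ ((∑ l, C (v ⬝ᵥ (S l *ᵥ v)) * (X : ℝ[X]) ^ d l).roots.toFinset.filter (fun t => 0 < t)).card + 1) :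
    ((Matrix.det (∑ k, ((X : ℝ[X]) ^ d k) • (S k).map C)).roots.toFinset.filter (fun t => 0 < t)).card
      ≤ (K - 1) * Fintype.card ι := by
  obtain ⟨a, σ, ha, ha0, -, hdef⟩ := exists_alternatingScales_of_rayleighSharp hK d hd S hS hsharp
  exact card_posRoots_le_of_alternatingMoments d S hS (K - 1) (by rw [Fintype.card_fin]; omega) a ha ha0 σ hdef

end Scales

end DefiniteMoments

end Summit.ValiantsHypothesis.ValiantsHypothesis.Theorems.LacunarySymmetroidMatrixDescartes
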